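import Literature.InformationTheory.Coding.HammingParityCheckMatrix
import Literature.InformationTheory.QuantumCodes.OptimalRadius
import Summits.Ventures.QEC.Basic.HypergraphProductCensus
import HarnessLib

/-!
# Ventures/QEC — the hypergraph product of two Hamming codes is `[[(2^r−1)² + r², (2^r−1−r)², 3]]` for every `r ≥ 2`,
# with optimal correction radius `1` — Q4 «theorem for families»

LADDER-QEC (venture cell `qec`), PARTITION row 08, item 08.QHAM, rung Q4 (label «theorem for families»).
The census calibration row `HGP_ham3_x_ham3` (`Census/HGP/Core1.lean`: `[[58, 16, 3]]` from the `decide`d classical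
certificates of the `3 × 7` seed) is the member `r = 3` of an infinite family settled here ONCE for all `r` from the
classical theorems of `Literature/InformationTheory/Coding/HammingParityCheckMatrix.lean` (`rank H_r = r`,
`d(ker H_r) = 3`, `ker H_rᵀ = 0`) through type-04's census bridge `HGP.isCode_of_le_transpose` (Tillich–Zémor Thm 1 /
Thm 7 / Thm 9 / Lemma 10, regime `min(d₁,d₂) ≤ d₁ᵀ, d₂ᵀ = ⊤`):

* `hamming_isCode (hr : 2 ≤ r) : (HGP.code (hamMatrix r) (hamMatrix r)).IsCode ((2^r−1)·(2^r−1) + r·r) ((2^r−1−r)·(2^r−1−r)) 3`;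
  instances `r = 2` (`[[13, 1, 3]]` — the seed `H_2` is the `2 × 3` check matrix of the repetition code, so this is
  the distance-3 planar surface code), `r = 3` (`[[58, 16, 3]]`, the parameters of the census row `HGP_ham3_x_ham3`,
  whose seed is `H_3` up to column order), `r = 4` (`[[241, 121, 3]]`);
* Q4: `hamming_minWeight_correctsUpTo` (minimum-weight sector decoding corrects every single bit flip and phase flip)
  and `hamming_radius_optimal` (no pair of sector decoders corrects all weight-2 patterns), every `r ≥ 2`.

TIER: CERTIFIED, KERNEL-std — pure corollaries (no `decide`, no data); axioms standard. HONEST FRAMING: the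
Tillich–Zémor theorem is proved upstream (`Literature/…/HypergraphProduct*.lean`, `Basic/HypergraphProductCensus.lean`);
this file contributes the classical seed family and the instantiation; no identification of the census row's matrix with
`hamMatrix 3` is claimed (equal parameters, seeds equal up to a column permutation).

References: [TillichZemor2014] Thm 1 (§6), Thm 7, Thm 9, Lemma 10 (arXiv v1 chunks p0007 L126-135, p0008 L11-15,
L57-62); [MacWilliamsSloane1977] Ch. 1 §7 (Hamming codes); [Gottesman1997] §2.3 (radius ⌊(d−1)/2⌋).
-/

namespace Summit.Ventures.QEC.HGP

open Matrix Literature.InformationTheory.QuantumCodes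
open Literature.InformationTheory.Coding (minDist)
open Literature.InformationTheory.Coding.HammingMatrix

variable {r : ℕ}

/-- **`HGP(H_r, H_r)` is `[[(2^r−1)² + r², (2^r−1−r)², 3]]` for every `r ≥ 2`** (Tillich–Zémor Thm 1 with the Hamming
parity-check matrix as the full-rank seed: `N = n² + (n−k)²`, `K = k²`, `D = d` with `[n,k,d] = [2^r−1, 2^r−1−r, 3]`).
[cite: TillichZemor2014, Thm 1 (§6) and Thm 7 / Thm 9 / Lemma 10 (arXiv v1 chunks p0007 L126-135, p0008 L11-15, L57-62)] [cite: MacWilliamsSloane1977, Ch. 1 §7 «Summary of Properties of Hamming Code» (p0031)] -/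
theorem hamming_isCode (hr : 2 ≤ r) :
    (HGP.code (hamMatrix r) (hamMatrix r)).IsCode ((2 ^ r - 1) * (2 ^ r - 1) + r * r)
      ((2 ^ r - 1 - r) * (2 ^ r - 1 - r)) 3 :=
  HGP.isCode_of_le_transpose (hamMatrix r) (hamMatrix r) (rank_hamMatrix r) (rank_hamMatrix r)
    (minDist_pcCode r hr) (minDist_pcCode r hr)
    (by rw [minDist_pcCode_transpose]; exact le_top) (by rw [minDist_pcCode_transpose]; exact le_top)
    rfl (by rw [Nat.sub_self, zero_mul, add_zero]) (min_self 3)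

/-- `r = 2`: `HGP(H_2, H_2)` is `[[13, 1, 3]]` (`H_2` = the `2 × 3` check matrix of the `[3,1,3]` repetition code: the
distance-3 planar surface code). [cite: TillichZemor2014, Thm 1 (§6)] -/
theorem hamming2_isCode : (HGP.code (hamMatrix 2) (hamMatrix 2)).IsCode 13 1 3 := hamming_isCode (r := 2) le_rfl

/-- `r = 3`: `HGP(H_3, H_3)` is `[[58, 16, 3]]` — the parameters of the census calibration row `HGP_ham3_x_ham3`.
[cite: TillichZemor2014, Thm 1 (§6)] -/
theorem hamming3_isCode : (HGP.code (hamMatrix 3) (hamMatrix 3)).IsCode 58 16 3 := hamming_isCode (r := 3) (by norm_num)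

/-- `r = 4`: `HGP(H_4, H_4)` is `[[241, 121, 3]]`. [cite: TillichZemor2014, Thm 1 (§6)] -/
theorem hamming4_isCode : (HGP.code (hamMatrix 4) (hamMatrix 4)).IsCode 241 121 3 :=
  hamming_isCode (r := 4) (by norm_num)

/-- **Q4, radius attained**: minimum-weight decoding of each sector of `HGP(H_r, H_r)` corrects every error pattern of
weight `≤ 1` (bit flips modulo `Z`-stabilizers, phase flips modulo `X`-stabilizers), every `r ≥ 2`.
[cite: TillichZemor2014, Thm 1 (§6)] [cite: Gottesman1997, §2.3 (chunk p0014 L3: a distance-d code corrects ⌊(d−1)/2⌋ errors)] -/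
theorem hamming_minWeight_correctsUpTo (hr : 2 ≤ r) :
    (Decoder.minWeight (HGP.code (hamMatrix r) (hamMatrix r)).zSyndrome hammingNorm).CorrectsUpTo
        (HGP.code (hamMatrix r) (hamMatrix r)).zSyndrome
        ((HGP.code (hamMatrix r) (hamMatrix r)).rowSpZ : Set (_ → ZMod 2)) hammingNorm 1 ∧
      (Decoder.minWeight (HGP.code (hamMatrix r) (hamMatrix r)).xSyndrome hammingNorm).CorrectsUpTo
        (HGP.code (hamMatrix r) (hamMatrix r)).xSyndrome
        ((HGP.code (hamMatrix r) (hamMatrix r)).rowSpX : Set (_ → ZMod 2)) hammingNorm 1 :=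
  ⟨(hamming_isCode hr).minWeight_correctsUpToZ, (hamming_isCode hr).minWeight_correctsUpToX⟩

/-- **Q4, radius optimal**: no pair of sector decoders of `HGP(H_r, H_r)` corrects all weight-`t` patterns in both
sectors unless `t ≤ 1`, every `r ≥ 2`. [cite: TillichZemor2014, Thm 1 (§6)] [cite: Gottesman1997, §2.3 (chunk p0014 L3)] -/
theorem hamming_radius_optimal (hr : 2 ≤ r)
    {DX : Decoder ((Fin (2 ^ r - 1) × Fin r) → ZMod 2) (((Fin (2 ^ r - 1) × Fin (2 ^ r - 1)) ⊕ (Fin r × Fin r)) → ZMod 2)}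
    {DZ : Decoder ((Fin r × Fin (2 ^ r - 1)) → ZMod 2) (((Fin (2 ^ r - 1) × Fin (2 ^ r - 1)) ⊕ (Fin r × Fin r)) → ZMod 2)}
    {t : ℕ}
    (hDX : DX.CorrectsUpTo (HGP.code (hamMatrix r) (hamMatrix r)).xSyndrome
      ((HGP.code (hamMatrix r) (hamMatrix r)).rowSpX : Set (_ → ZMod 2)) hammingNorm t)
    (hDZ : DZ.CorrectsUpTo (HGP.code (hamMatrix r) (hamMatrix r)).zSyndrome
      ((HGP.code (hamMatrix r) (hamMatrix r)).rowSpZ : Set (_ → ZMod 2)) hammingNorm t) :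
    t ≤ 1 :=
  (hamming_isCode hr).le_half_of_correctsUpTo_sectors hDX hDZ

end Summit.Ventures.QEC.HGP
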